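import Summits.HubbardSuperconductivity.HubbardSuperconductivity.Theorems.AnisotropyChordTransferFibre3MinAttained

/-!
# Route `AnisotropyChord` / H0 rotor rung: PORT N30-A — `CertLogic` needs only the FORWARD Krein inequality

Remark on the theorem target `KreinThree` of `…TransferFibre3` (theory seat `hubbard-h0-rotor-theory-1`, cycle 20, §277(a)/§278):
the certificate logic uses the Krein identity only in the direction «`ε₁ + T` is a `K₁` sector eigenvalue ⇒ `Φ(T)` is not
above `T`».  With Mathlib's total matrix inverse (`𝒩⁻¹ = 0` when `𝒩(T)` is singular, so that `Φ(T) = 0 < T` there) this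
direction reads `Φ(T) ≤ T` and does NOT require the invertibility of the Krein matrix `𝒩(T)`; the typed biconditional
`KreinThree` does (at a singular `𝒩(T)` an eigenfunction without pole component would violate `↔`).  We therefore type the
weaker, sufficient hypothesis and prove `CertLogic` from it:

* `KreinForward L Δ` : `∀ T ∈ (0, 2ε₁)`, `IsSectorEigenvalue K₁ Δ (ε₁ + T) → Phi T Δ ≤ T`;
* `kreinForward_of_kreinThree` : `KreinThree → KreinForward`;
* **`certLogic_of_kreinForward`** : `KreinForward L Δ → CertLogic L Δ` (with `sectorMinAttained_holds`).

Prover seat `hubbard-h0-rotor-p1` g21; helper for stmt-HubbardSuperconductivity-19089 (`--supports`).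
-/

set_option linter.dupNamespace false
set_option autoImplicit false

noncomputable section

namespace Summit.HubbardSuperconductivity.HubbardSuperconductivity.Theorems.AnisotropyChord.Transfer.Fibre3

variable (L : ℕ) [NeZero L]

/-- **KREIN, forward direction** (the only one the certificate consumes): for `0 < T < 2ε₁`, if `ε₁ + T` is an eigenvalue of
the symmetric hard-core `K₁` sector then `Φ(T) ≤ T` (`= T` when the Krein matrix `𝒩(T)` is invertible, `Φ(T) = 0` by the
total-inverse convention otherwise). [conjecture: PORT SPEC N30-A theorem target, theory seat hubbard-h0-rotor-theory-1,
cycle 20, memo ROTOR-THEORY-20 §277(a) — to be proved (plane-wave diagonalisation of `H₀`, pole-removed resolvent, block algebra)] -/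
def KreinForward (Δ : ℝ) : Prop :=
  ∀ T : ℝ, 0 < T → T < 2 * eps1 L → IsSectorEigenvalue L (K1 L) Δ (eps1 L + T) → Phi L T Δ ≤ T

/-- the biconditional implies the forward inequality. [folklore] -/
theorem kreinForward_of_kreinThree {Δ : ℝ} (hK : KreinThree L Δ) : KreinForward L Δ :=
  fun T h0 h2 hE => le_of_eq ((hK T h0 h2).1 hE)

/-- **`CertLogic` from the forward Krein inequality and MIN-ATTAINED.** [folklore] -/
theorem certLogic_of_kreinForward_of_minAttained {Δ : ℝ} (hK : KreinForward L Δ)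
    (hmin : SectorMinAttained L (K1 L) Δ) : CertLogic L Δ := by
  intro Tstar _ hT2 hNB hPhi hG F hF
  obtain ⟨G, hGadm, hGle⟩ := hG
  obtain ⟨E, hEeig, hEmin⟩ := hmin F hF
  have hE1 : eps1 L < E := hNB E hEeig
  have hT : Tstar < E - eps1 L := by
    by_contra h
    rw [not_lt] at h
    have hT0' : 0 < E - eps1 L := by linarith
    have hlt2 : E - eps1 L < 2 * eps1 L := lt_of_le_of_lt h hT2
    have hle : Phi L (E - eps1 L) Δ ≤ E - eps1 L := by
      apply hK (E - eps1 L) hT0' hlt2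
      have e : eps1 L + (E - eps1 L) = E := by ring
      rw [e]; exact hEeig
    have := hPhi (E - eps1 L) hT0' h
    linarith
  refine ⟨G, hGadm, ?_⟩
  have := hEmin F hF
  linarith

/-- **`CertLogic` from the forward Krein inequality** (MIN-ATTAINED is a theorem, `sectorMinAttained_holds`). [folklore] -/
theorem certLogic_of_kreinForward {Δ : ℝ} (hK : KreinForward L Δ) : CertLogic L Δ :=
  certLogic_of_kreinForward_of_minAttained L hK (sectorMinAttained_holds L (K1 L) Δ)

end Summit.HubbardSuperconductivity.HubbardSuperconductivity.Theorems.AnisotropyChord.Transfer.Fibre3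

end
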